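import Summits.ResolutionOfSingularities.ResolutionOfSingularities.Theses.HilbertSamuelElimination
import Summits.ResolutionOfSingularities.ResolutionOfSingularities.Theorems.HilbertSamuelEliminationModificationsResolveWellFounded
import Summits.ResolutionOfSingularities.ResolutionOfSingularities.Theorems.HilbertSamuelEliminationModificationsResolveDenseComplMaxLocus
import Summits.ResolutionOfSingularities.ResolutionOfSingularities.Theorems.HilbertSamuelEliminationModificationsResolveFiniteDim
import Summits.ResolutionOfSingularities.ResolutionOfSingularities.Theorems.HilbertSamuelEliminationModificationsResolveDenseOpenDim
import Literature.AlgebraicGeometry.Resolution.ComponentGluing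
import Literature.AlgebraicGeometry.Resolution.HilbertSamuelSemicontinuityExcellentDim
import Literature.AlgebraicGeometry.Resolution.ExcellentRingsFieldProofs
import Mathlib.AlgebraicGeometry.Morphisms.Proper
import Mathlib.AlgebraicGeometry.Noetherian
import HarnessLib

/-!
# `ModificationsResolve` (crux stmt-ResolutionOfSingularities-18507, route HilbertSamuelElimination)
— line `Sketch` (one-step well-founded induction): the crux PROVED

**Crux.** `SigmaMaxModifications → ∀ p, p.Prime → ResolutionInChar.{0} p`
(Cossart–Jannsen–Saito, LNM 2270, Cor. 6.18 with Thm. 6.17).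

**Line.** No tower is ever composed.  Fix the field `k` and the level `N`.  On `Scheme.{0}`
consider the ONE-STEP relation `R_{k,N} Y' Y`: "`Y` is a non-empty `k`-scheme locally of finite
type and quasi-compact with `dim Y < N`, and there is a proper `π : Y' ⟶ Y` along which `H^N`
does not increase and after which no maximal value of `H^N_Y` survives (ME2)".  A descending
`R`-chain is literally an infinite tower of the kind CJS Thm. 6.17 forbids (tree
`Scheme.no_infinite_hsFun_tower_of_isExcellent`), so `R` is well founded
(`stub_wellFounded_hsStep`).  The crux is then ONE `WellFounded.induction` with motive
"every reduced separated finite-type `k`-structure on `Y` with `dim Y < N` has a resolution":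
a regular `Y` is its own resolution; otherwise crux 2 (`E = SigmaMaxModifications`) at level `N`
gives a proper `π : Y' ⟶ Y` which is an isomorphism over the open `U = Y ∖ Y_max`
(`Y_max` closed by Bennett–Singh u.s.c., `Scheme.isClosed_hsMaxLocus_of_isExcellent_of_dim`,
which needs `dim Y < N` STRICTLY — hence the motive carries `<`, and `N := dim X + 1` at the
start, `stub_exists_nat_topologicalKrullDim_le`), `U` dense (`stub_dense_compl_hsMaxLocus`:
`Y_max ⊆ Y ∖ Reg Y` and `Reg Y` is dense on a reduced scheme), with dense preimage (E), hence
birational; `dim Y' ≤ dim Y < N` (`stub_topologicalKrullDim_le_of_isIso_restrict`, the one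
non-plumbing step: a dense open of a finite-type `k`-scheme has full dimension); the induction
hypothesis resolves `Y'` and `Scheme.HasResolution.of_isBirational` transports the resolution
down `π`.  The inline `H` of the route file is `Scheme.hsFun` on the nose (`rfl`), so E's
clauses are exactly `hmono` / (ME2) of the termination theorem.

The four stubs are the landed helper files (`--supports stmt-ResolutionOfSingularities-18507`)
`HilbertSamuelEliminationModificationsResolveWellFounded` (`stub_wellFounded_hsStep`, Thm. 6.17),
`…DenseComplMaxLocus` (`stub_dense_compl_hsMaxLocus`), `…FiniteDim`
(`stub_exists_nat_topologicalKrullDim_le`) and `…DenseOpenDim`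
(`stub_topologicalKrullDim_le_of_isIso_restrict`); this file is the sorry-free composition
`ModificationsResolve_of`, re-exported as `Theorems.ModificationsResolve_proof`.  No named fact is
assumed (`Stacks07QW_field` is discharged in the tree); crux 2 enters only as the hypothesis of the
crux itself.

Sources: V. Cossart, U. Jannsen, S. Saito, *Desingularization: Invariants and Strategy*, LNM 2270
(2020), Thm. 6.17, Cor. 6.18, Rem. 6.13; The Stacks Project, Tag 01RN (birational).
-/

set_option linter.dupNamespace false -- mandated namespace of this single-conjunct summit

noncomputable section

open CategoryTheory AlgebraicGeometry TopologicalSpace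
open Literature.AlgebraicGeometry.Resolution
open Summit.ResolutionOfSingularities.ResolutionOfSingularities.Theses.HilbertSamuelElimination

namespace Summit.ResolutionOfSingularities.ResolutionOfSingularities.Theorems.ModificationsResolve.Sketch

/-! ## Composition -/

/-- **The induction (CJS Cor. 6.18 at a fixed level `N`).** For every field `k` of
characteristic `p` and every `N`, crux 2 implies: every reduced separated `k`-scheme of finite
type `Y` with `dim Y < N` has a resolution — by well-founded induction along
`stub_wellFounded_hsStep`, one Σ^max-modification at a time.
[cite: CossartJannsenSaito2020, Cor. 6.18] -/
theorem hasResolution_of_topologicalKrullDim_lt (hE : SigmaMaxModifications) {p : ℕ}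
    (hp : p.Prime) (k : Type) [Field k] [CharP k p] (N : ℕ) (Y : Scheme.{0}) :
    ∀ (g : Y ⟶ Spec (.of k)), IsSeparated g → LocallyOfFiniteType g → QuasiCompact g →
      IsReduced Y → topologicalKrullDim Y < (N : WithBot ℕ∞) → Scheme.HasResolution Y := by
  induction Y using (stub_wellFounded_hsStep k N).induction with
  | _ Y ih => ?_
  intro g hsep hlft hqc hred hdim
  by_cases hreg : Scheme.IsRegular Y
  · exact hreg.hasResolution
  -- a non-regular scheme is non-empty
  haveI hne : Nonempty Y := by
    by_contra h
    exact hreg fun y => (h ⟨y⟩).elim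
  -- one Σ^max-modification at level `N` (crux 2)
  obtain ⟨Y', π, hπ, hred', -, hiso, hdense, hmono, hME2⟩ :=
    hE p hp k Y g hsep hlft hqc hred hreg N hdim.le
  -- `Y` is Noetherian and excellent, so `Y_max` is closed (`dim Y < N`)
  haveI : IsLocallyNoetherian Y := LocallyOfFiniteType.isLocallyNoetherian g
  haveI : CompactSpace Y := QuasiCompact.compactSpace_of_compactSpace g
  haveI : IsNoetherian Y := {}
  have hexc : Scheme.IsExcellent Y :=
    Scheme.isExcellent_of_locallyOfFiniteType Stacks07QW_field_holds g
  have hclosed : IsClosed (Scheme.hsMaxLocus Y N) :=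
    Scheme.isClosed_hsMaxLocus_of_isExcellent_of_dim hexc hdim
  let U : Y.Opens := ⟨(Scheme.hsMaxLocus Y N)ᶜ, hclosed.isOpen_compl⟩
  have hUdense : Dense (U : Set Y) := stub_dense_compl_hsMaxLocus g hreg hdim.le
  -- E's (ME1) clauses, read through `H = Scheme.hsFun` (rfl)
  haveI hisoU : IsIso (π ∣_ U) := hiso U subset_rfl
  have hdense' : Dense ((π ⁻¹ᵁ U : Y'.Opens) : Set Y') := hdense
  have hbir : IsBirational π := ⟨U, hUdense, hdense', hisoU⟩
  -- the new stage
  haveI := hπ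
  haveI : IsReduced Y' := hred'
  haveI : IsLocallyNoetherian Y' := LocallyOfFiniteType.isLocallyNoetherian (π ≫ g)
  haveI : CompactSpace Y' := QuasiCompact.compactSpace_of_compactSpace (π ≫ g)
  haveI : IsNoetherian Y' := {}
  have hdim' : topologicalKrullDim Y' < (N : WithBot ℕ∞) :=
    (stub_topologicalKrullDim_le_of_isIso_restrict g π U hdense').trans_lt hdim
  have hR : (∃ g : Y ⟶ Spec (.of k), LocallyOfFiniteType g ∧ QuasiCompact g) ∧ Nonempty Y ∧
      topologicalKrullDim Y < (N : WithBot ℕ∞) ∧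
      ∃ π : Y' ⟶ Y, IsProper π ∧
        (∀ x' : Y', Scheme.hsFun Y' N x' ≤ Scheme.hsFun Y N (π.base x')) ∧
        ∀ ν : ℕ → ℕ, Maximal (· ∈ Scheme.hsValues Y N) ν → ν ∉ Scheme.hsValues Y' N :=
    ⟨⟨g, hlft, hqc⟩, hne, hdim, π, hπ, hmono, hME2⟩
  have hres' : Scheme.HasResolution Y' :=
    ih Y' hR (π ≫ g) inferInstance inferInstance inferInstance hred' hdim'
  exact ComponentGluing.Scheme.HasResolution.of_isBirational π hbir hres'

/-- **CJS Cor. 6.18 with Thm. 6.17: Σ^max-modifications resolve.** Crux 2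
(`SigmaMaxModifications`) implies `ResolutionInChar p` for every prime `p`: run the induction
`hasResolution_of_topologicalKrullDim_lt` at the level `N = dim X + 1`
(`stub_exists_nat_topologicalKrullDim_le`). [cite: CossartJannsenSaito2020, Cor. 6.18] -/
theorem ModificationsResolve_of :
    Summit.ResolutionOfSingularities.ResolutionOfSingularities.Theses.HilbertSamuelElimination.ModificationsResolve := by
  intro hE p hp k _ _ X f hsep hlft hqc hred
  obtain ⟨d, hd⟩ := stub_exists_nat_topologicalKrullDim_le f
  refine hasResolution_of_topologicalKrullDim_lt hE hp k (d + 1) X f hsep hlft hqc hred ?_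
  exact hd.trans_lt (by exact_mod_cast Nat.lt_succ_self d)

end Summit.ResolutionOfSingularities.ResolutionOfSingularities.Theorems.ModificationsResolve.Sketch

namespace Summit.ResolutionOfSingularities.ResolutionOfSingularities.Theorems

/-- **Crux `ModificationsResolve` of route HilbertSamuelElimination, settled** (CJS Cor. 6.18 with
Thm. 6.17): Σ^max-modifications (crux 2) imply resolution of singularities in every positive
characteristic.  Re-export of `ModificationsResolve.Sketch.ModificationsResolve_of` under the
conventional closing name. [cite: CossartJannsenSaito2020, Cor. 6.18] -/
theorem ModificationsResolve_proof :
    Summit.ResolutionOfSingularities.ResolutionOfSingularities.Theses.HilbertSamuelElimination.ModificationsResolve :=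
  ModificationsResolve.Sketch.ModificationsResolve_of

end Summit.ResolutionOfSingularities.ResolutionOfSingularities.Theorems

end
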